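import Literature.AlgebraicGeometry.Resolution.MuPTorsorLocalUniformizationCore
import Literature.AlgebraicGeometry.Resolution.ZariskiPatchingProperModelsWeakLU
import Summits.ResolutionOfSingularities.ResolutionOfSingularities.Theorems.SoloInformedNonAbhyankar
import HarnessLib

/-!
# Resolution in characteristic `p` = proper two-model patching ∧ the core `μ_p`-torsor step

Summit-side packaging of `Literature/…/MuPTorsorLocalUniformizationCore.lean` (Temkin 2013
relative form + Cossart–Piltant 2019 in dimension `≤ 3` + Cutkosky 2022) with Zariski–Piltant
patching of proper models in its weak-LU form
(`Literature/…/ZariskiPatchingProperModelsWeakLU.lean`):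

* `coreStepsAt_of_resolutionInChar` — resolution in characteristic `p` implies the CORE torsor
  steps (`a ∉ K₀`, `trdeg_k K₀(a) > 3`, `O ∩ K₀(a)` non-Abhyankar) at every valuation ring over
  every field of characteristic `p` (unconditional);
  `not_resolutionOfSingularities_of_not_coreStepsAt` — the kill switch in core form;
* `resolutionOverUpToDim_of_coreStepsAt_of_properPatching` — over an ARBITRARY field `k` of
  characteristic `p`: `Temkin2013Relative` + `CossartPiltant2019LU3` + the core steps at the
  valuation rings of finitely generated extensions of `k` + two-model patching of PROPER models
  over `k` ⇒ `ResolutionOverUpToDim k d` for every `d`;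
* `resolutionInChar_iff_twoModelPatching_and_coreSteps` — **the exact split**: granted the two
  published theorems `Temkin2013Relative` and `CossartPiltant2019LU3`,
  `ResolutionInChar p ↔ ProperModel.TwoModelPatching p ∧ (core steps everywhere)`
  (the core hypothesis is spelled out, not abbreviated, in every statement).
  Both conjuncts are open in dimension `≥ 4` and known in dimension `≤ 3`;
  `resolutionOfSingularities_iff_twoModelPatching_and_coreSteps` — the same for the summit
  statement itself (all primes, universe `0`).
-/

noncomputable section

namespace Summit.ResolutionOfSingularities.ResolutionOfSingularities.Theorems

open CategoryTheory AlgebraicGeometry IsLocalRing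
open Literature.AlgebraicGeometry Literature.AlgebraicGeometry.Resolution

universe u

/-- Resolution in characteristic `p` implies the core torsor steps everywhere (unconditional). -/
theorem coreStepsAt_of_resolutionInChar {p : ℕ} (h : ResolutionInChar.{u} p) :
    ∀ (k K : Type u) [Field k] [CharP k p] [Field K] [Algebra k K],
      (⊤ : IntermediateField k K).FG → ∀ O : ValuationSubring K,
        (∀ c : k, algebraMap k K c ∈ O) → MuPTorsorCoreStepsAt p k O :=
  fun k K _ _ _ _ _ O _ =>
    (muPTorsorLocalUniformizationInChar_of_resolutionInChar h k K O).coreStepsAt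

/-- **Kill switch, core form.** A single valuation ring over a single field of characteristic
`p` at which a CORE torsor step fails refutes resolution of singularities. -/
theorem not_resolutionOfSingularities_of_not_coreStepsAt {p : ℕ} (hp : p.Prime)
    {k K : Type} [Field k] [CharP k p] [Field K] [Algebra k K] (O : ValuationSubring K)
    (h : ¬ MuPTorsorCoreStepsAt p k O) :
    ¬ Literature.AlgebraicGeometry.Resolution.ResolutionOfSingularities :=
  fun hR => h (muPTorsorLocalUniformizationInChar_of_resolutionOfSingularities hR p hp
    k K O).coreStepsAt

/-- **Core steps over `k` + Temkin (relative) + Cossart–Piltant (dim ≤ 3) + proper two-model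
patching over `k` ⇒ weak resolution over `k` in every dimension**, for an arbitrary field `k`
of characteristic `p`. -/
theorem resolutionOverUpToDim_of_coreStepsAt_of_properPatching {p : ℕ} [Fact p.Prime]
    (hT : Temkin2013Relative.{u}) (hCP : CossartPiltant2019LU3.{u}) {k : Type u} [Field k]
    [CharP k p]
    (H : ∀ (K : Type u) [Field K] [Algebra k K], (⊤ : IntermediateField k K).FG →
      ∀ O : ValuationSubring K, (∀ c : k, algebraMap k K c ∈ O) → MuPTorsorCoreStepsAt p k O)
    (hZ : ∀ (K : Type u) [Field K] [Algebra k K] [Algebra.EssFiniteType k K],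
      ∀ M₁ M₂ : ProperModel k K,
        ∃ (N : ProperModel k K) (φ₁ : N.Hom M₁) (φ₂ : N.Hom M₂), φ₁.RegLe ∧ φ₂.RegLe)
    (d : ℕ) : ResolutionOverUpToDim k d :=
  resolutionOverUpToDim_of_properPatching_of_lu hZ
    (fun K _ _ hfg O hO => isLocallyUniformizable_of_coreStepsAt hT hCP hfg O hO (H K hfg O hO))
    d

/-- **The exact split of the summit's `p`-component.** Granted Temkin's inseparable local
uniformization (relative smooth form) and Cossart–Piltant's resolution in dimension `≤ 3`,
resolution of singularities in characteristic `p` is EQUIVALENT to the conjunction of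
(global) two-model patching of proper models and (local) the core `μ_p`-torsor steps, over all
fields of characteristic `p`. -/
theorem resolutionInChar_iff_twoModelPatching_and_coreSteps {p : ℕ} [Fact p.Prime]
    (hT : Temkin2013Relative.{u}) (hCP : CossartPiltant2019LU3.{u}) :
    ResolutionInChar.{u} p ↔ ProperModel.TwoModelPatching.{u} p ∧
      (∀ (k K : Type u) [Field k] [CharP k p] [Field K] [Algebra k K],
        (⊤ : IntermediateField k K).FG → ∀ O : ValuationSubring K,
          (∀ c : k, algebraMap k K c ∈ O) → MuPTorsorCoreStepsAt p k O) :=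
  ⟨fun h => ⟨ProperModel.twoModelPatching_of_resolutionInChar h,
      coreStepsAt_of_resolutionInChar h⟩,
    fun h => resolutionInChar_of_properTwoModelPatching_of_lu h.1
      ((localUniformizationInChar_iff_coreStepsAt hT hCP).mpr h.2)⟩

/-- The same with the full Cossart–Piltant theorem `CossartPiltant2019` (resolution in
dimension `≤ 3` over every field) in place of its local-uniformization corollary. -/
theorem resolutionInChar_iff_twoModelPatching_and_coreSteps' {p : ℕ} [Fact p.Prime]
    (hT : Temkin2013Relative.{u}) (hCP : CossartPiltant2019.{u}) :
    ResolutionInChar.{u} p ↔ ProperModel.TwoModelPatching.{u} p ∧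
      (∀ (k K : Type u) [Field k] [CharP k p] [Field K] [Algebra k K],
        (⊤ : IntermediateField k K).FG → ∀ O : ValuationSubring K,
          (∀ c : k, algebraMap k K c ∈ O) → MuPTorsorCoreStepsAt p k O) :=
  resolutionInChar_iff_twoModelPatching_and_coreSteps hT hCP.lu3

/-- **Exact local proxy, core form.** Given Temkin (relative) and Cossart–Piltant (dim ≤ 3):
resolution in characteristic `p` implies, and local uniformization in characteristic `p` is
equivalent to, the core torsor steps over every field of characteristic `p`. -/
theorem resolutionInChar_localProxy_core {p : ℕ} [Fact p.Prime] (hT : Temkin2013Relative.{u})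
    (hCP : CossartPiltant2019LU3.{u}) :
    (ResolutionInChar.{u} p →
      ∀ (k K : Type u) [Field k] [CharP k p] [Field K] [Algebra k K],
        (⊤ : IntermediateField k K).FG → ∀ O : ValuationSubring K,
          (∀ c : k, algebraMap k K c ∈ O) → MuPTorsorCoreStepsAt p k O) ∧
      (LocalUniformizationInChar.{u} p ↔
      ∀ (k K : Type u) [Field k] [CharP k p] [Field K] [Algebra k K],
        (⊤ : IntermediateField k K).FG → ∀ O : ValuationSubring K,
          (∀ c : k, algebraMap k K c ∈ O) → MuPTorsorCoreStepsAt p k O) :=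
  ⟨coreStepsAt_of_resolutionInChar, localUniformizationInChar_iff_coreStepsAt hT hCP⟩

/-- **The summit itself, split.** Granted Temkin (relative) and Cossart–Piltant (dim ≤ 3) in
universe `0`: resolution of singularities in positive characteristic (the summit statement,
verbatim `Literature.AlgebraicGeometry.Resolution.ResolutionOfSingularities`) is EQUIVALENT to:
for every prime `p`, two-model patching of proper models in characteristic `p` AND the core
`μ_p`-torsor steps in characteristic `p`. -/
theorem resolutionOfSingularities_iff_twoModelPatching_and_coreSteps
    (hT : Temkin2013Relative.{0}) (hCP : CossartPiltant2019LU3.{0}) :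
    Literature.AlgebraicGeometry.Resolution.ResolutionOfSingularities ↔
      ∀ p : ℕ, p.Prime → ProperModel.TwoModelPatching.{0} p ∧
      (∀ (k K : Type) [Field k] [CharP k p] [Field K] [Algebra k K],
        (⊤ : IntermediateField k K).FG → ∀ O : ValuationSubring K,
          (∀ c : k, algebraMap k K c ∈ O) → MuPTorsorCoreStepsAt p k O) := by
  refine forall_congr' fun p => forall_congr' fun hp => ?_
  haveI : Fact p.Prime := ⟨hp⟩
  exact resolutionInChar_iff_twoModelPatching_and_coreSteps hT hCP

end Summit.ResolutionOfSingularities.ResolutionOfSingularities.Theorems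

end
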